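import Literature.AlgebraicGeometry.HodgeTheory.ComplexTorusLatticeCoordinatesHodge
import Literature.NumberTheory.Transcendental.AbelianVarietyAnalyticLieGroup
import Literature.NumberTheory.Transcendental.AnalytificationMorphismsProofs
import HarnessLib

/-!
# Riemann's theorem (fullness of `H¹_B`) from «compact complex Lie groups are tori»

Family `hodge`, layer `Literature/AlgebraicGeometry/HodgeTheory`, next to
`AbelianVarietyHodgeFullnessOfUniformisation.lean` (the PROVED assembly
`deligneMilne1982_Thm_6_20_full_of_uniformisation :
(U) → (C) → (G) → DeligneMilne1982_Thm_6_20_full`).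
Of its three inputs, (C) `complexTorus_latticeCoordHOne_hodgeOneZero` is now a theorem
(`complexTorus_latticeCoordHOne_hodgeOneZero_holds`, `ComplexTorusLatticeCoordinatesHodge.lean`)
and so is (G) GAGA for maps (`Transcendental.arapura2012_cor_15_4_6_holds`); and (U), the
uniformisation of complex abelian varieties ([Shimura1998] §3.1), is reduced by
`Transcendental.complexAbelianVariety_torusUniformised_of_lieAddGroup`
(`AbelianVarietyAnalyticLieGroup.lean`: the analytification of `A` IS a compact connected
commutative complex Lie group, [MumfordAV1970] §1 (1)) to the purely Lie-theoretic lemma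
[LangeBirkenhake1992] Lemma 1.1.2 «Any connected compact complex Lie group of dimension `g` is a
complex torus», in the weak form: a holomorphic homeomorphic group isomorphism
`ComplexTorus Φ ≃+ G`, `Φ : ℝ^ι ≃L[ℝ] ℂⁿ`.

This file records the resulting ONE-HYPOTHESIS form of Riemann's theorem
([DeligneMilne1982Tannakian] Thm. 6.20, fullness of `A ↦ H¹(A(ℂ), ℚ)` on complex abelian
varieties up to isogeny = the displayed record `HodgeTheory.DeligneMilne1982_Thm_6_20_full`):

* `deligneMilne1982_Thm_6_20_full_of_lieAddGroup` — `DeligneMilne1982_Thm_6_20_full` holds as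
  soon as every compact connected commutative complex Lie group modelled on `ℂⁿ` is
  (holomorphically, homeomorphically, as a group) a complex torus `ComplexTorus Φ`.

Not here: Lange–Birkenhake Lemma 1.1.2 itself (exponential map of a compact commutative complex
Lie group); with it, `DeligneMilne1982_Thm_6_20_full` becomes an unconditional theorem by this
file.

## References

* P. Deligne, J. S. Milne, *Tannakian categories*, LNM 900 (1982), Thm. 6.20.
  [DeligneMilne1982Tannakian]
* H. Lange, Ch. Birkenhake, *Complex Abelian Varieties* (1992), §1.1 Lemma 1.1.2, Thm. 1.1.21.
  [LangeBirkenhake1992]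
* D. Mumford, *Abelian Varieties* (1970), §1 (1). [MumfordAV1970]
* G. Shimura, *Abelian Varieties with Complex Multiplication and Modular Functions* (1998),
  §3.1. [Shimura1998]
-/

noncomputable section

open scoped Manifold ContDiff
open Literature.Geometry.Kaehler (ComplexTorus)
open Literature.NumberTheory.Transcendental (complexAbelianVariety_torusUniformised_of_lieAddGroup
  arapura2012_cor_15_4_6_holds)

namespace Literature.AlgebraicGeometry.HodgeTheory

/-- **Riemann's theorem from «compact commutative complex Lie groups are tori».**
[DeligneMilne1982Tannakian] Thm. 6.20 (fullness: every morphism of the weight-one Hodge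
structures `H¹(B(ℂ),ℚ) → H¹(A(ℂ),ℚ)` of complex abelian varieties is, up to a positive integer,
induced by a homomorphism `A → B`) — the tree's displayed record `DeligneMilne1982_Thm_6_20_full` —
follows from the single Lie-theoretic hypothesis `hLB` = [LangeBirkenhake1992] Lemma 1.1.2 in weak
form (for every compact connected Hausdorff commutative complex Lie group `G` modelled on `ℂⁿ`
there are `Φ : ℝ^ι ≃L[ℝ] ℂⁿ` and a group isomorphism `ComplexTorus Φ ≃+ G` which is a
homeomorphism and holomorphic).  Proof: the proved assembly
`deligneMilne1982_Thm_6_20_full_of_uniformisation` with (U) from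
`Transcendental.complexAbelianVariety_torusUniformised_of_lieAddGroup hLB` (the analytification of
`A` is such a Lie group, [MumfordAV1970] §1 (1)), (C)
`complexTorus_latticeCoordHOne_hodgeOneZero_holds` and (G)
`Transcendental.arapura2012_cor_15_4_6_holds`.
[cite: DeligneMilne1982Tannakian, Thm. 6.20 (Riemann), p. 212]
[cite: LangeBirkenhake1992, §1.1 Lemma 1.1.2] -/
theorem deligneMilne1982_Thm_6_20_full_of_lieAddGroup
    (hLB : ∀ (n : ℕ) (G : Type) [AddCommGroup G] [TopologicalSpace G] [T2Space G] [CompactSpace G]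
      [ConnectedSpace G] [ChartedSpace (Fin n → ℂ) G] [LieAddGroup 𝓘(ℂ, Fin n → ℂ) ω G],
      ∃ (ι : Type) (_ : Fintype ι) (Φ : (ι → ℝ) ≃L[ℝ] (Fin n → ℂ)) (e : ComplexTorus Φ ≃+ G),
        IsHomeomorph e ∧ MDifferentiable 𝓘(ℂ, Fin n → ℂ) 𝓘(ℂ, Fin n → ℂ) e) :
    DeligneMilne1982_Thm_6_20_full :=
  deligneMilne1982_Thm_6_20_full_of_uniformisation
    (complexAbelianVariety_torusUniformised_of_lieAddGroup hLB)
    complexTorus_latticeCoordHOne_hodgeOneZero_holds arapura2012_cor_15_4_6_holds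

end Literature.AlgebraicGeometry.HodgeTheory

end
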